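import Literature.Analysis.UnboundedOperators.HeatKernelHeatEquation
import HarnessLib

/-!
# Time regularity of the heat semigroup on `Lᵖ`, uniformly at parabolic scale

Analysis/UnboundedOperators proof file (no definitions, no named facts) for the heat-semigroup
toolkit (`HeatKernel*.lean`; Evans, *PDE*, §2.3.1; Giga–Giga–Saal, *Nonlinear PDEs*, §1.1). It
proves the qualitative form of the analyticity estimate `‖(e^{hΔ} - 1) e^{τΔ}‖_{Lᵖ→Lᵖ} ≲ h/τ`:

* `heatKernel_mul_sqrt_smul`: the two-parameter parabolic scaling `G_{τa}(√τ w) = (√τ)^{-n} G_a(w)`;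
* `integral_abs_heatKernel_sub_mul`: `∫ |G_{τa} - G_{τb}| = ∫ |G_a - G_b|` — the `L¹` distance of
  two kernels depends only on the ratio of the times;
* `tendsto_integral_abs_heatKernel_add_sub`: `∫ |G_{1+r} - G_1| → 0` as `r → 0⁺` (dominated
  convergence under `2(4π)^{-n/2}e^{-‖w‖²/8}`);
* `heatExtension_sub_heatExtension_eq_convolution`, `eLpNorm_heatExtension_sub_le`: Young's
  inequality for differences of caloric extensions of `Lᵖ` data,
  `‖e^{tΔ}g - e^{sΔ}g‖_p ≤ ‖G_t - G_s‖₁ ‖g‖_p`;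
* `exists_eLpNorm_heatExtension_sub_le`: for every `η > 0` there is `δ > 0` with
  `‖e^{(τ+h)Δ}g - e^{τΔ}g‖_{Lᵖ} ≤ η ‖g‖_{Lᵖ}` whenever `0 ≤ h ≤ δτ`, for **all** `g ∈ Lᵖ(E; F)`,
  `1 ≤ p ≤ ∞` — time regularity of `e^{τΔ}` uniform over bounded sets of data, at the parabolic
  scale `h ∼ τ`.

The last statement is what the `C_t Lᵖ` continuity of Oseen's scheme for the Navier–Stokes
equations consumes (Lemarié-Rieusset 2016, proof of Thm. 7.5, PDF p. 157:
`W_{ν(t-s)} - W_{ν(θ-s)} = ∫_θ^t νΔW_{ν(τ-s)} dτ`; the tree's consumer is the continuity file of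
the discharge of `kato_local_bounded`).

## Mathlib / tree search

Tree: `heatKernel_eq`, `heatKernel_pos`, `continuous_heatKernel`, `integrable_heatKernel_holds`,
`memLp_heatKernel`, `convolutionExistsAt_of_memLp`, `eLpNorm_convolution_le_lintegral_enorm_mul`
(`HeatKernel.lean`), `heatKernel_one_eq_sqrt_pow_mul_heatKernel` (the case `a = 1` of the scaling,
`HeatKernelHeatEquation.lean`), `integrable_gaussian_of_pos` (`HeatKernelGradient.lean`),
`tendsto_heatExtension_nhdsWithin_zero` (strong continuity at `0`, per datum — not uniform).
Mathlib: `Measure.integral_comp_smul`, `tendsto_integral_filter_of_dominated_convergence`,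
`ContinuousAt.rpow_const`, `Metric.tendsto_nhdsWithin_nhds`,
`ofReal_integral_norm_eq_lintegral_enorm`.

## References

* L. C. Evans, *Partial Differential Equations*, 2nd ed., AMS 2010, §2.3.1 (the fundamental
  solution and its scaling). [Evans2010]
* P. G. Lemarié-Rieusset, *The Navier–Stokes Problem in the 21st Century*, CRC Press 2016,
  doi:10.1201/b19556, proof of Thm. 7.5, PDF p. 157 (time continuity of the Duhamel term).
  [LemarieRieusset2016]
-/

noncomputable section

open MeasureTheory Filter Topology Set Metric
open scoped Real ENNReal NNReal Convolution

namespace Literature.Analysis.UnboundedOperators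

variable {E : Type*} [NormedAddCommGroup E] [InnerProductSpace ℝ E] [FiniteDimensional ℝ E]
  [MeasurableSpace E] [BorelSpace E]

/-! ### Two-parameter parabolic scaling of the kernel -/

omit [FiniteDimensional ℝ E] [MeasurableSpace E] [BorelSpace E] in
/-- **Parabolic scaling with a parameter**: `G_{τa}(√τ w) = (√τ)^{-n} G_a(w)` for `τ, a > 0`
(Evans, *PDE*, §2.3.1; `heatKernel_one_eq_sqrt_pow_mul_heatKernel` is the case `a = 1`).
[folklore] -/
theorem heatKernel_mul_sqrt_smul {τ a : ℝ} (hτ : 0 < τ) (ha : 0 < a) (w : E) :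
    heatKernel (τ * a) (Real.sqrt τ • w) =
      (Real.sqrt τ ^ Module.finrank ℝ E)⁻¹ * heatKernel a w := by
  set n : ℕ := Module.finrank ℝ E with hn
  rw [heatKernel_eq, heatKernel_eq]
  have h1 : ‖Real.sqrt τ • w‖ ^ 2 = τ * ‖w‖ ^ 2 := by
    rw [norm_smul, Real.norm_of_nonneg (Real.sqrt_nonneg τ), mul_pow, Real.sq_sqrt hτ.le]
  have h2 : (Real.sqrt τ ^ n)⁻¹ = τ ^ (-(n : ℝ) / 2) := by
    rw [Real.sqrt_eq_rpow, ← Real.rpow_natCast, ← Real.rpow_mul hτ.le, ← Real.rpow_neg hτ.le]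
    congr 1
    ring
  have h3 : (4 * π * (τ * a)) ^ (-(n : ℝ) / 2) =
      τ ^ (-(n : ℝ) / 2) * (4 * π * a) ^ (-(n : ℝ) / 2) := by
    rw [show 4 * π * (τ * a) = τ * (4 * π * a) by ring]
    exact Real.mul_rpow hτ.le (by positivity)
  have h5 : -(1 / (4 * (τ * a))) * (τ * ‖w‖ ^ 2) = -(1 / (4 * a)) * ‖w‖ ^ 2 := by
    field_simp
  rw [h1, h2, h3, h5]
  ring

/-- **The `L¹` distance of two heat kernels only depends on the ratio of the times**:
`∫ |G_{τa} - G_{τb}| = ∫ |G_a - G_b|` for `τ, a, b > 0` (substitute `z = √τ w`). [folklore] -/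
theorem integral_abs_heatKernel_sub_mul {τ a b : ℝ} (hτ : 0 < τ) (ha : 0 < a) (hb : 0 < b) :
    ∫ z : E, |heatKernel (τ * a) z - heatKernel (τ * b) z| =
      ∫ w : E, |heatKernel a w - heatKernel b w| := by
  have hR : 0 < Real.sqrt τ ^ Module.finrank ℝ E := pow_pos (Real.sqrt_pos.2 hτ) _
  have hf : ∀ w : E, |heatKernel (τ * a) (Real.sqrt τ • w) - heatKernel (τ * b) (Real.sqrt τ • w)| =
      (Real.sqrt τ ^ Module.finrank ℝ E)⁻¹ * |heatKernel a w - heatKernel b w| := fun w => by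
    rw [heatKernel_mul_sqrt_smul hτ ha, heatKernel_mul_sqrt_smul hτ hb, ← mul_sub, abs_mul,
      abs_of_pos (inv_pos.2 hR)]
  -- `∫ f(√τ w) dw = (√τ)^{-n} ∫ f`
  have h := Measure.integral_comp_smul (volume : Measure E)
    (fun z : E => |heatKernel (τ * a) z - heatKernel (τ * b) z|) (Real.sqrt τ)
  simp only [hf, integral_const_mul, smul_eq_mul, abs_of_pos (inv_pos.2 hR)] at h
  exact (mul_left_cancel₀ (inv_pos.2 hR).ne' h).symm

/-! ### `L¹` continuity of the kernel in time at `t = 1` -/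

omit [FiniteDimensional ℝ E] [MeasurableSpace E] [BorelSpace E] in
/-- Continuity of `s ↦ G_s(w)` on `(0, ∞)` at each point. [folklore] -/
theorem continuousAt_heatKernel_time {s : ℝ} (hs : 0 < s) (w : E) :
    ContinuousAt (fun r : ℝ => heatKernel r w) s := by
  have h : (fun r : ℝ => heatKernel r w) = fun r =>
      (4 * π * r) ^ (-(Module.finrank ℝ E : ℝ) / 2) * Real.exp (-(1 / (4 * r)) * ‖w‖ ^ 2) :=
    funext fun r => heatKernel_eq r w
  rw [h]
  refine ContinuousAt.mul ?_ ?_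
  · exact ContinuousAt.rpow_const (by fun_prop) (Or.inl (by positivity))
  · exact (Real.continuous_exp.continuousAt).comp
      (ContinuousAt.mul (ContinuousAt.neg (continuousAt_const.div (by fun_prop) (by positivity)))
        continuousAt_const)

omit [FiniteDimensional ℝ E] [MeasurableSpace E] [BorelSpace E] in
/-- Gaussian domination of the kernels with times in `[1, 2]`:
`G_s(w) ≤ (4π)^{-n/2} exp(-‖w‖²/8)`. [folklore] -/
theorem heatKernel_le_gaussian_of_mem_Icc {s : ℝ} (hs : s ∈ Icc (1 : ℝ) 2) (w : E) :
    heatKernel s w ≤ (4 * π) ^ (-(Module.finrank ℝ E : ℝ) / 2) * Real.exp (-(1 / 8) * ‖w‖ ^ 2) := by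
  have hs0 : 0 < s := by linarith [hs.1]
  rw [heatKernel_eq]
  refine mul_le_mul ?_ ?_ (Real.exp_pos _).le (by positivity)
  · rw [Real.mul_rpow (by positivity) hs0.le]
    refine mul_le_of_le_one_right (by positivity) ?_
    exact Real.rpow_le_one_of_one_le_of_nonpos hs.1 (by
      have : (0 : ℝ) ≤ Module.finrank ℝ E := by positivity
      linarith [div_nonneg this (by norm_num : (0:ℝ) ≤ 2)])
  · refine Real.exp_le_exp.2 (mul_le_mul_of_nonneg_right (neg_le_neg ?_) (by positivity))
    rw [div_le_div_iff₀ (by norm_num) (by positivity)]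
    linarith [hs.2]

/-- **`L¹` continuity of the heat kernel in time at `t = 1`**:
`∫ |G_{1+r} - G_1| → 0` as `r → 0⁺` (dominated convergence under the Gaussian
`2 (4π)^{-n/2} e^{-‖w‖²/8}`). [folklore] -/
theorem tendsto_integral_abs_heatKernel_add_sub :
    Tendsto (fun r : ℝ => ∫ w : E, |heatKernel (1 + r) w - heatKernel 1 w|) (𝓝[≥] 0) (𝓝 0) := by
  set bound : E → ℝ := fun w =>
    2 * ((4 * π) ^ (-(Module.finrank ℝ E : ℝ) / 2) * Real.exp (-(1 / 8) * ‖w‖ ^ 2)) with hbound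
  have hint : Integrable bound (volume : Measure E) :=
    ((integrable_gaussian_of_pos (E := E) (by norm_num : (0:ℝ) < 1 / 8)).const_mul _).const_mul _
  have key : Tendsto (fun r : ℝ => ∫ w : E, |heatKernel (1 + r) w - heatKernel 1 w|) (𝓝[≥] 0)
      (𝓝 (∫ w : E, |heatKernel (1 + 0) w - heatKernel 1 w|)) := by
    refine tendsto_integral_filter_of_dominated_convergence bound ?_ ?_ hint ?_
    · exact Eventually.of_forall fun r =>
        ((continuous_heatKernel (1 + r)).sub (continuous_heatKernel 1)).abs.aestronglyMeasurable
    · have hmem : ∀ᶠ r in 𝓝[≥] (0 : ℝ), r ∈ Icc (0 : ℝ) 1 := by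
        filter_upwards [self_mem_nhdsWithin, mem_nhdsWithin_of_mem_nhds (Iic_mem_nhds one_pos)]
          with r hr hr'
        exact ⟨hr, hr'⟩
      filter_upwards [hmem] with r hr
      refine Eventually.of_forall fun w => ?_
      rw [Real.norm_eq_abs, abs_abs]
      have h1 : heatKernel (1 + r) w ≤ _ :=
        heatKernel_le_gaussian_of_mem_Icc ⟨by linarith [hr.1], by linarith [hr.2]⟩ w
      have h2 : heatKernel 1 w ≤ _ := heatKernel_le_gaussian_of_mem_Icc ⟨le_rfl, by norm_num⟩ w
      have h1' : 0 < heatKernel (1 + r) w := heatKernel_pos (by linarith [hr.1]) w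
      have h2' : 0 < heatKernel 1 w := heatKernel_pos one_pos w
      rw [hbound]
      exact (abs_sub _ _).trans (by rw [abs_of_pos h1', abs_of_pos h2']; linarith)
    · refine Eventually.of_forall fun w => ?_
      have hc : Tendsto (fun r : ℝ => heatKernel (1 + r) w) (𝓝[≥] 0) (𝓝 (heatKernel 1 w)) := by
        have h := (continuousAt_heatKernel_time one_pos w).tendsto
        have h2 : Tendsto (fun r : ℝ => 1 + r) (𝓝[≥] (0 : ℝ)) (𝓝 1) := by
          have : Tendsto (fun r : ℝ => 1 + r) (𝓝 (0 : ℝ)) (𝓝 (1 + 0)) :=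
            (continuous_const.add continuous_id).tendsto 0
          rw [add_zero] at this
          exact this.mono_left nhdsWithin_le_nhds
        exact h.comp h2
      have := (hc.sub_const (heatKernel 1 w)).abs
      simpa using this
  simpa using key

/-! ### Young: differences of caloric extensions -/

variable {F : Type*} [NormedAddCommGroup F] [NormedSpace ℝ F]

/-- **Differences of caloric extensions are convolutions with kernel differences**:
`e^{tΔ}g(x) - e^{sΔ}g(x) = ((G_t - G_s) ⋆ g)(x)` for `g ∈ Lᵖ`, `1 ≤ p`, `s, t > 0`. [folklore] -/
theorem heatExtension_sub_heatExtension_eq_convolution {g : E → F} {p : ℝ≥0∞}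
    (hg : MemLp g p volume) (hp : 1 ≤ p) {s t : ℝ} (hs : 0 < s) (ht : 0 < t) (x : E) :
    heatExtension g t x - heatExtension g s x =
      ((fun z => heatKernel t z - heatKernel s z) ⋆[ContinuousLinearMap.lsmul ℝ ℝ, volume] g)
        x := by
  haveI : p.HolderConjugate (ENNReal.conjExponent p) := .conjExponent hp
  have hq : 1 ≤ ENNReal.conjExponent p := ENNReal.HolderConjugate.one_le (ENNReal.conjExponent p) p
  have hKt :=
    convolutionExistsAt_of_memLp (ContinuousLinearMap.lsmul ℝ ℝ) (memLp_heatKernel ht hq) hg x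
  have hKs :=
    convolutionExistsAt_of_memLp (ContinuousLinearMap.lsmul ℝ ℝ) (memLp_heatKernel hs hq) hg x
  rw [heatExtension_apply, heatExtension_apply, convolution_def]
  have hKt' : Integrable (fun y => heatKernel t y • g (x - y)) volume := by
    simpa [ConvolutionExistsAt] using hKt
  have hKs' : Integrable (fun y => heatKernel s y • g (x - y)) volume := by
    simpa [ConvolutionExistsAt] using hKs
  rw [← integral_sub hKt' hKs']
  refine integral_congr_ae (Eventually.of_forall fun y => ?_)
  simp

/-- **Young for differences of caloric extensions**:
`‖e^{tΔ}g - e^{sΔ}g‖_p ≤ (∫ |G_t - G_s|) ‖g‖_p`, `1 ≤ p`, `s, t > 0`. [folklore] -/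
theorem eLpNorm_heatExtension_sub_le [CompleteSpace F] {g : E → F} {p : ℝ≥0∞}
    (hg : MemLp g p volume) (hp : 1 ≤ p) {s t : ℝ} (hs : 0 < s) (ht : 0 < t) :
    eLpNorm (heatExtension g t - heatExtension g s) p volume ≤
      ENNReal.ofReal (∫ z : E, |heatKernel t z - heatKernel s z|) * eLpNorm g p volume := by
  set K : E → ℝ := fun z => heatKernel t z - heatKernel s z with hK
  have hKc : Continuous K := (continuous_heatKernel t).sub (continuous_heatKernel s)
  have hKi : Integrable K := (integrable_heatKernel_holds ht).sub (integrable_heatKernel_holds hs)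
  have heq : heatExtension g t - heatExtension g s =
      (K ⋆[ContinuousLinearMap.lsmul ℝ ℝ, volume] g) :=
    funext fun x => heatExtension_sub_heatExtension_eq_convolution hg hp hs ht x
  rw [heq]
  refine (eLpNorm_convolution_le_lintegral_enorm_mul hKc.aestronglyMeasurable hg.1 hp).trans ?_
  rw [← ofReal_integral_norm_eq_lintegral_enorm hKi]
  rfl

/-! ### The modulus of continuity at parabolic scale -/

/-- **Time regularity of the heat semigroup on `Lᵖ`, uniformly at parabolic scale**: for every
`η > 0` there is `δ > 0` such that `‖e^{(τ+h)Δ}g - e^{τΔ}g‖_{Lᵖ} ≤ η ‖g‖_{Lᵖ}` whenever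
`0 < τ`, `0 ≤ h ≤ δ τ`, for all `g ∈ Lᵖ(E; F)`, `1 ≤ p ≤ ∞` (Young with `‖G_{τ+h} - G_τ‖_{L¹} =
‖G_{1+h/τ} - G_1‖_{L¹}`, which tends to `0` with `h/τ`; the qualitative form of the analyticity
bound `‖(e^{hΔ} - 1)e^{τΔ}‖ ≲ h/τ`, Evans, *PDE*, §2.3.1; Lemarié-Rieusset 2016, proof of Thm. 7.5,
PDF p. 157, `W_{ν(t-s)} - W_{ν(θ-s)} = ∫ νΔW dτ`). [folklore] -/
theorem exists_eLpNorm_heatExtension_sub_le [CompleteSpace F] {η : ℝ} (hη : 0 < η) :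
    ∃ δ : ℝ, 0 < δ ∧ ∀ {g : E → F} {p : ℝ≥0∞}, MemLp g p volume → 1 ≤ p →
      ∀ {τ h : ℝ}, 0 < τ → 0 ≤ h → h ≤ δ * τ →
        eLpNorm (heatExtension g (τ + h) - heatExtension g τ) p volume ≤
          ENNReal.ofReal η * eLpNorm g p volume := by
  -- `ω(r) = ∫ |G_{1+r} - G_1| < η` for `0 ≤ r ≤ δ`
  have h := Metric.tendsto_nhdsWithin_nhds.1 (tendsto_integral_abs_heatKernel_add_sub (E := E)) η hη
  obtain ⟨ε, hε, hω⟩ := h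
  refine ⟨ε / 2, by positivity, fun {g p} hg hp {τ h'} hτ hh' hle => ?_⟩
  set r : ℝ := h' / τ with hr
  have hr0 : 0 ≤ r := div_nonneg hh' hτ.le
  have hrε : r < ε := by
    rw [hr, div_lt_iff₀ hτ]
    nlinarith
  have hωr : ∫ w : E, |heatKernel (1 + r) w - heatKernel 1 w| < η := by
    have h1 := hω (show r ∈ Ici (0:ℝ) from hr0)
      (by rwa [dist_zero_right, Real.norm_eq_abs, abs_of_nonneg hr0])
    rwa [dist_zero_right, Real.norm_eq_abs,
      abs_of_nonneg (integral_nonneg fun w => abs_nonneg _)] at h1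
  have hτh : τ + h' = τ * (1 + r) := by rw [hr]; field_simp
  calc eLpNorm (heatExtension g (τ + h') - heatExtension g τ) p volume
      ≤ ENNReal.ofReal (∫ z : E, |heatKernel (τ + h') z - heatKernel τ z|) * eLpNorm g p volume :=
        eLpNorm_heatExtension_sub_le hg hp hτ (by positivity)
    _ = ENNReal.ofReal (∫ w : E, |heatKernel (1 + r) w - heatKernel 1 w|) * eLpNorm g p volume := by
        rw [hτh, show heatKernel τ = heatKernel (E := E) (τ * 1) by rw [mul_one],
          integral_abs_heatKernel_sub_mul hτ (by positivity) one_pos]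
    _ ≤ ENNReal.ofReal η * eLpNorm g p volume := by
        gcongr

end Literature.Analysis.UnboundedOperators
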